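import Mathlib
import HarnessLib
import HarnessLib.Audit
import Summits.HodgeConjecture.HodgeConjecture.Theses.EightfoldTwistedSheafSeeds
import Summits.HodgeConjecture.HodgeConjecture.Theorems.Ring2SemiregularRepresentativesVHC
import Literature.AlgebraicGeometry.HodgeTheory.ChernCharacterBetti
import Literature.AlgebraicGeometry.HodgeTheory.ChernCharacterBettiLaws
import Summits.HodgeConjecture.HodgeConjecture.Theorems.EightfoldBlochSeedsChernCharacterOnBettiByName

/-!
# Skeleton `Lines/grothendieck-axiomatic` for crux `ChernCharacterOnBetti` (stmt-HodgeConjecture-19780)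

HONEST FRAMING: a crux PROOF SKELETON (cruxes-workfile class) for the shared CONSTRUCTION item
`ChernCharacterOnBetti = Nonempty ChernCharacterBetti` (routes TensorMonadSeeds ∕ EightfoldTwistedSheafSeeds ∕
FirstOrderSemiregularSeeds ∕ KleimanBFSeeds ∕ VHCAbelianSchemesRoad; decl of record
`Ring2.SemiregularRepresentatives.ChernCharacterOnBetti`). Nothing is constructed here: the `sorry`s sit exactly
inside the registered `stub_*` declarations; nothing toward K-C⁺, K2, rung H2, HC_AV or HC.

STRATEGY (line-writer seat `linewriter-hodgeav-h2sheaf` g0, 2026-08-31) — GROTHENDIECK'S AXIOMATIC ROAD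
(Grothendieck 1958 «La théorie des classes de Chern», Thm. 1; Fulton §3.2 / §15.1; Voisin I Thm. 11.23, 11.32):
the eleven fields of `ChernCharacterBetti` split into NINE "topological" laws (congruence, additivity on short
exact sequences of vector bundles, functoriality along all `ℂ`-morphisms, the two normalisations on trivial
bundles, the exponential on line bundles, rationality) and TWO "cycle" laws on smooth projective varieties
(algebraicity `chᵢ(E) ∈ Nⁱ H²ⁱ`, span `Nᵖ H²ᵖ ⊆ ℂ·{ch_p(E)}`). The line isolates them:

* `stub_rung_firstChernClass` — RUNG (the degree-1 ∕ line-bundle special case of the construction, outside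
  the tree's regime: the tree has `c₁` only in HODGE cohomology `H¹(Ω¹)` — `atiyahChernCharacterOne`,
  `StandardChernCharacterBetti.lean` — and no Chern class in Betti cohomology at all): a FIRST CHERN CLASS
  `c₁(L) ∈ H²(X(ℂ); ℂ)` of line bundles, natural, vanishing on `𝒪_X`, rational, algebraically supported
  on smooth projective `X` (Lefschetz (1,1) direction "divisor class"), and NON-DEGENERATE (some line bundle
  on some `ℙᴺ` has `c₁ ≠ 0`). Intended witness: the connecting map of the exponential sequence on `X(ℂ)`
  composed with `H²(X(ℂ); ℤ) → H²(X(ℂ); ℂ)`, or `(1/2πi)·realize ∘ Tr(-At)`. [M/L]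
* `stub_extendBySplitting` — Grothendieck's extension: every lawful non-degenerate `c₁` extends to a
  lawful topological Chern character `ch` on all vector bundles agreeing with `c₁` on line bundles over
  projective spaces (projective bundle theorem `H*(ℙ(E)(ℂ)) = H*(X(ℂ))[ξ]/(Σ cᵢ ξ^{r-i})` by Leray–Hirsch,
  then the splitting principle for additivity and the exponential). [XL — the Mathlib-scale part; missing
  Mathlib decls: Leray–Hirsch for `singularCohomology`, the projective bundle `ℙ(E) → X` with `𝒪(1)` and
  its cohomology ring, Chern roots ∕ splitting principle, GAGA analytification of algebraic vector bundles
  (tree: `IsAnalytifiedVectorBundle` is a predicate only), `CharacteristicClasses.ChernClassTheory`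
  (tree hypothesis structure, existence `chernClassTheory_nonempty` undischarged).]
* `stub_algebraicity` — for EVERY lawful topological `ch`: `chᵢ(E)` is algebraically supported on smooth
  projective `X` (RIGIDITY: functoriality + additivity + the exponential pin `ch` down to `λⁱ·ch^{std}` on
  smooth projective varieties via the flag bundle and Künneth on `ℙᵃ × ℙᵇ`; then Fulton Prop. 19.1.2:
  `chᵢ(E) = cl(chᵢ(E) ∩ [X])`). [L]
* `stub_span` — for every lawful NON-DEGENERATE `ch`: `Nᵖ H²ᵖ(X(ℂ); ℂ) ⊆ ℂ·{ch_p(E)}` on smooth projective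
  `X` (rigidity with `λ ≠ 0`; resolution property + Riemann–Roch without denominators `ch(𝒪_Z) = [Z] + …`,
  Fulton Ex. 15.2.16 (b), 15.3.6, Lemma 19.1.1). The non-degeneracy binder is NECESSARY: the "rank-only"
  character `ch₀ = rk`, `ch_{>0} = 0` satisfies all nine topological laws and algebraicity, and violates span.
  [L]

COMPOSITION `ChernCharacterOnBetti_of` (sorry-free given the stubs): rung ⟶ extension ⟶ assemble the
structure with the two cycle fields supplied by `stub_algebraicity` ∕ `stub_span` (non-degeneracy of `ch` is
inherited from `c₁` through the agreement clause).

WHY THIS SPLIT IS GENUINE (not a shred): no stub alone gives the crux (`stub_extendBySplitting` produces no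
cycle fields; the two `∀ ch` stubs produce no `ch`); the hard construction is named (`stub_extendBySplitting`,
XL) and separated from the two comparison theorems, each a printed theorem with its own proof
(Fulton 19.1.2; Fulton 15.2.16 (b)); the rung is load-bearing.

References: [Grothendieck1958Chern] Thm. 1 and §3; [Fulton1998] Example 3.2.3, §15.1, Example 15.2.16 (b),
Prop. 19.1.2; [VoisinHodgeI2002] Thm. 11.23, Prop. 11.27, Thm. 11.32, Thm. 7.33 (Leray–Hirsch);
[Hirzebruch1966] §4; [Huybrechts2005] §4.4.
-/

-- every declaration of this problem lives in `Summit.HodgeConjecture.HodgeConjecture.…` (summit = sub-problem)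
set_option linter.dupNamespace false

noncomputable section

open CategoryTheory CategoryTheory.Limits AlgebraicGeometry
open Literature.AlgebraicGeometry.Motives Literature.AlgebraicGeometry.HodgeTheory
open Literature.AlgebraicTopology.SingularHomology

namespace Summit.HodgeConjecture.HodgeConjecture.Cruxes.ChernCharacterOnBetti.GrothendieckAxiomatic

/-! The vocabulary — `ChernDatum`, `ChernDatum.IsTopological` (the nine-minus-two topological laws, field types verbatim the
fields of `ChernCharacterBetti`), `ChernDatum.NonDegenerate`, `FirstChernDatum`, `FirstChernDatum.IsFirstChernClass`,
`FirstChernDatum.NonDegenerate` — is the Literature file `HodgeTheory/ChernCharacterBettiLaws.lean` (p835237); the former crux-local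
copies are deleted (officer AUDIT 152 (I1)–(I4): identical field for field). -/

/-- RUNG STUB (open, load-bearing, first prover target, M/L): a lawful non-degenerate first Chern class of
line bundles on complex Betti cohomology EXISTS (exponential sequence ∕ `(1/2πi)·Tr(-At)` realised). -/
theorem stub_rung_firstChernClass : ∃ c₁ : FirstChernDatum, c₁.IsFirstChernClass ∧ c₁.NonDegenerate := by
  sorry

/-- STUB (open, load-bearing, XL — the Mathlib-scale construction): Grothendieck's extension of a lawful
non-degenerate `c₁` to a lawful topological Chern character on all vector bundles (projective bundle theorem
by Leray–Hirsch, splitting principle), agreeing with `c₁` on line bundles over projective spaces.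
[cite: Grothendieck1958Chern, Thm. 1] [cite: VoisinHodgeI2002, Thm. 7.33 and Thm. 11.23] -/
theorem stub_extendBySplitting :
    ∀ c₁ : FirstChernDatum, c₁.IsFirstChernClass → c₁.NonDegenerate →
      ∃ ch : ChernDatum, ch.IsTopological ∧
        ∀ (N : ℕ) (L : (projectiveSpace N ℂ).left.Modules), HasRankLE L 1 →
          ch (projectiveSpace N ℂ) L 1 = c₁ (projectiveSpace N ℂ) L := by
  sorry

/-- STUB (open, load-bearing, L): ALGEBRAICITY for every lawful topological Chern character — on a smooth
projective variety the Chern character of a vector bundle is algebraically supported (rigidity to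
`λⁱ·ch^{std}` + Fulton Prop. 19.1.2). [cite: Fulton1998, Prop. 19.1.2] [cite: VoisinHodgeI2002, Thm. 11.32] -/
theorem stub_algebraicity :
    ∀ ch : ChernDatum, ch.IsTopological →
      ∀ {n : ℕ} {X : SchemeOver ℂ}, IsSmoothProjective n X →
        ∀ (E : X.left.Modules), IsVectorBundle E → ∀ i : ℕ, ch X E i ∈ algebraicClasses X i :=
  Summit.HodgeConjecture.HodgeConjecture.Theorems.stub_algebraicity_holds'

/-- STUB (open, load-bearing, XL ∕ K2-class; the RESHAPE of R19.944 (2) ∕ R19.951 (r-vii′) — SpanForOne7): the SPAN LAW in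
positive degrees for ONE lawful non-degenerate Chern datum `ch₀` = the `hex` hypothesis of `Theorems.stub_span_of_spanForOne`
(p835457) VERBATIM (GRR leading term ∕ Fulton Example 15.2.16 (b); memo §2–§3 of hand-19780 g5). -/
theorem stub_spanForOne :
    ∃ ch₀ : ChernDatum, ch₀.IsTopological ∧ ch₀.NonDegenerate ∧
      ∀ {n : ℕ} {X : SchemeOver ℂ}, IsSmoothProjective n X → ∀ {p : ℕ}, 0 < p →
        algebraicClasses X p ≤ Submodule.span ℂ {c | ∃ E : X.left.Modules, IsVectorBundle E ∧ ch₀ X E p = c} := by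
  sorry

/-- STUB (open, load-bearing, L): SPAN for every lawful NON-DEGENERATE topological Chern character — on a
smooth projective variety every algebraically supported class is a `ℂ`-combination of `ch_p` of vector
bundles (rigidity with `λ ≠ 0` + resolution property + Riemann–Roch without denominators).
[cite: Fulton1998, Example 15.2.16 (b) and Example 15.3.6] [cite: Deligne2000, §2 Remark (ii)] -/
theorem stub_span :
    ∀ ch : ChernDatum, ch.IsTopological → ch.NonDegenerate →
      ∀ {n : ℕ} {X : SchemeOver ℂ}, IsSmoothProjective n X → ∀ p : ℕ,
        algebraicClasses X p ≤
          Submodule.span ℂ {c | ∃ E : X.left.Modules, IsVectorBundle E ∧ ch X E p = c} :=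
  Summit.HodgeConjecture.HodgeConjecture.Theorems.stub_span_of_spanForOne stub_spanForOne

/-- **Composition** (the ONLY theorem of this file concluding the crux): the stubs give
`ChernCharacterOnBetti` BY NAME. -/
theorem ChernCharacterOnBetti_of :
    Summit.HodgeConjecture.HodgeConjecture.Theses.EightfoldTwistedSheafSeeds.ChernCharacterOnBetti := by
  obtain ⟨c₁, hc₁, hnd₁⟩ := stub_rung_firstChernClass
  obtain ⟨ch, hch, hagree⟩ := stub_extendBySplitting c₁ hc₁ hnd₁
  have hnd : ch.NonDegenerate := by
    obtain ⟨N, L, hL, hne⟩ := hnd₁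
    exact ⟨N, L, hL, by rw [hagree N L hL]; exact hne⟩
  exact ⟨{ ch := ch
           ch_congr := fun e i => hch.ch_congr e i
           ch_shortExact := fun S hS h₁ h₃ i => hch.ch_shortExact S hS h₁ h₃ i
           map_ch := fun f E hE i => hch.map_ch f E hE i
           ch_free_zero := fun X I _ => hch.ch_free_zero X I
           ch_free_of_pos := fun X I _ i hi => hch.ch_free_of_pos X I hi
           ch_of_hasRankLE_one := fun hL i hi => hch.ch_of_hasRankLE_one hL hi
           isRationalClass_ch := fun X E hE i => hch.isRationalClass_ch X E hE i
           ch_mem_algebraicClasses := fun hX E hE i => stub_algebraicity ch hch hX E hE i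
           algebraicClasses_le_span_ch := fun hX p => stub_span ch hch hnd hX p }⟩

end Summit.HodgeConjecture.HodgeConjecture.Cruxes.ChernCharacterOnBetti.GrothendieckAxiomatic


end
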